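import Literature.Computability.Complexity.QuadraticCongruences
import Literature.Computability.Complexity.CanonicalCodes
import Literature.Computability.Complexity.KnapsackPartition
import HarnessLib

/-!
# QUADRATIC CONGRUENCES ∈ NP (Manders–Adleman 1978, §2; Garey–Johnson [AN1])

Machine half no. 1 of the NP-completeness of `QUADCONG` (`QuadraticCongruences.lean`, the named fact
`isNPComplete_QUADCONG`): **membership in `NP`**. Manders–Adleman (J. Comput. System Sci. 16 (1978),
§2, proof of Thms. 1–2): "Both problems considered are solvable by a nondeterministic 'guess a
solution and check whether it is correct' algorithm in polynomial time, and hence in NP. This is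
because … there is a bound on the size of possible solutions … given by a polynomial in the
coefficients `α, β, γ`." Here the certificate of a code `⟨⌜a⌝, ⟨⌜b⌝, ⌜c⌝⟩⟩` is a numeral of the
solution `x` (`0 < x < c`, so `|⌜x⌝| ≤ |⌜c⌝| ≤ |code|`), and the verifier `QuadCong.verQ` (brick
assembly, no machine written) decides the `P`-language

  `{⟨w, y⟩ | w = code (a, b, c) canonical, 0 < a, 0 < b, 0 < ⟦y⟧ < c, ⟦y⟧² mod b = a mod b}`

(canonical-code test by `CanonCode.canonPairFn` / `Brick.canonF`, comparisons `ltFn`, arithmetic `prodFn` / `remFn` of `StackBricksArith.lean`,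
equality of canonical numerals `eqPairFn`).

Main results: `QuadCong.verQ_mem_FP`, `QuadCong.verQ_encode` (value on genuine codes),
`QuadCong.verLangQ_mem_P`, **`QUADCONG_mem_NP`**.

## References

* [MandersAdleman1978] K. L. Manders, L. Adleman, *NP-complete decision problems for binary
  quadratics*, J. Comput. System Sci. 16 (1978) 168–184, §2 (proof of Thms. 1–2: membership in NP).
* [GareyJohnson1979] M. R. Garey, D. S. Johnson, *Computers and Intractability*, Freeman 1979,
  §A7.1 [AN1]; §2.1 (languages of decision problems).
* [AroraBarak2009] S. Arora, B. Barak, *Computational Complexity*, CUP 2009, Def. 2.1 (NP by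
  certificates), §1.3 (closure of polynomial time under composition).
-/

noncomputable section

namespace Literature.Computability.Complexity

namespace QuadCong

open _root_.Computability Polynomial Brick CanonCode Knapsack

/-! ### Canonical codes of triples -/

/-- The triple of naturals read off any string (total form of `encodingQuadCong.decode`: the three
components by `boolUnpair`, each numeral by Mathlib's total `decodeNat`). [cite: AroraBarak2009, §0.1] -/
def decQ (w : List Bool) : ℕ × ℕ × ℕ :=
  (decodeNat (boolUnpair w).1, decodeNat (boolUnpair (boolUnpair w).2).1,
    decodeNat (boolUnpair (boolUnpair w).2).2)

/-- The decoder of `encodingQuadCong` is total with value `decQ`. [folklore] -/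
theorem decode_Q (w : List Bool) : encodingQuadCong.decode w = some (decQ w) := by
  simp [encodingQuadCong, Encoding.pairBool, encodingNatBool, decQ]

/-- The total decoder inverts the encoder. [folklore] -/
theorem decQ_encode (p : ℕ × ℕ × ℕ) : decQ (encodingQuadCong.encode p) = p := by
  have h := decode_Q (encodingQuadCong.encode p)
  rw [encodingQuadCong.decode_encode] at h
  exact (Option.some.inj h).symm

/-- **Canonical re-encoding of triple codes**: `⟨canonF fst, ⟨canonF fst∘snd, canonF snd∘snd⟩⟩`
(`canonPairFn` twice over the numeral canonicaliser `Brick.canonF`). [cite: AroraBarak2009, §0.1] -/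
def canonQFn : List Bool → List Bool := canonPairFn canonF (canonPairFn canonF canonF)

/-- `canonQFn ∈ FP`. [cite: AroraBarak2009, §1.3] -/
theorem canonQFn_mem_FP : canonQFn ∈ FP :=
  canonPairFn_mem_FP canonF_mem_FP (canonPairFn_mem_FP canonF_mem_FP canonF_mem_FP)

/-- **`canonQFn w = encode (decQ w)`.** [folklore] -/
theorem canonQFn_eq (w : List Bool) : canonQFn w = encodingQuadCong.encode (decQ w) := by
  have hin := fun u => (canonPairFn_eq encodingNatBool encodingNatBool decodeNat decodeNat decode_natBool
    decode_natBool (ca := canonF) (cb := canonF) canonF_eq_encodeNat_decodeNat canonF_eq_encodeNat_decodeNat u)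
  have h := canonPairFn_eq encodingNatBool (encodingNatBool.pairBool encodingNatBool) decodeNat
    (fun u => (decodeNat (boolUnpair u).1, decodeNat (boolUnpair u).2)) decode_natBool (fun u => (hin u).1)
    (ca := canonF) (cb := canonPairFn canonF canonF) canonF_eq_encodeNat_decodeNat (fun u => (hin u).2) w
  exact h.2

/-- **The code test** `isCanonQFn w = [encode (decQ w) = w]`. [cite: AroraBarak2009, §1.3] -/
def isCanonQFn : List Bool → List Bool := eqPairFn ∘ fanoutFn canonQFn id

/-- `isCanonQFn ∈ FP`. [cite: AroraBarak2009, §1.3] -/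
theorem isCanonQFn_mem_FP : isCanonQFn ∈ FP :=
  comp_mem_FP eqPairFn_mem_FP (fanoutFn_mem_FP canonQFn_mem_FP OracleCompose.id_mem_FP)

/-- Value of the code test. [folklore] -/
theorem isCanonQFn_apply (w : List Bool) :
    isCanonQFn w = [decide (encodingQuadCong.encode (decQ w) = w)] := by
  rw [isCanonQFn, Function.comp_apply, fanoutFn_apply, eqPairFn_boolPair, canonQFn_eq]; rfl

/-- The code test is one-bit. [folklore] -/
theorem oneBit_isCanonQFn : OneBit isCanonQFn := fun w => ⟨_, isCanonQFn_apply w⟩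

/-- A member of `QUADCONG` re-encodes to itself. [folklore] -/
theorem encode_decQ_of_mem {x : List Bool} (h : x ∈ QUADCONG) : encodingQuadCong.encode (decQ x) = x := by
  obtain ⟨p, -, rfl⟩ := h
  rw [decQ_encode]

/-! ### The pieces of the verifier (on `z = ⟨w, y⟩`, `w = ⟨⌜a⌝, ⟨⌜b⌝, ⌜c⌝⟩⟩`) -/

/-- The numeral `⌜a⌝`. [folklore] -/
def aQ : List Bool → List Bool := fstF ∘ fstF

/-- The numeral `⌜b⌝`. [folklore] -/
def bQ : List Bool → List Bool := fstF ∘ sndF ∘ fstF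

/-- The numeral `⌜c⌝`. [folklore] -/
def cQ : List Bool → List Bool := sndF ∘ sndF ∘ fstF

/-- `aQ ∈ FP`. [folklore] -/
theorem aQ_mem_FP : aQ ∈ FP := comp_mem_FP fstF_mem_FP fstF_mem_FP

/-- `bQ ∈ FP`. [folklore] -/
theorem bQ_mem_FP : bQ ∈ FP := comp_mem_FP fstF_mem_FP (comp_mem_FP sndF_mem_FP fstF_mem_FP)

/-- `cQ ∈ FP`. [folklore] -/
theorem cQ_mem_FP : cQ ∈ FP := comp_mem_FP sndF_mem_FP (comp_mem_FP sndF_mem_FP fstF_mem_FP)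

/-- `aQ` on a genuine argument. [folklore] -/
@[simp] theorem aQ_apply (a b c y : List Bool) : aQ (boolPair (boolPair a (boolPair b c)) y) = a := by simp [aQ]

/-- `bQ` on a genuine argument. [folklore] -/
@[simp] theorem bQ_apply (a b c y : List Bool) : bQ (boolPair (boolPair a (boolPair b c)) y) = b := by simp [bQ]

/-- `cQ` on a genuine argument. [folklore] -/
@[simp] theorem cQ_apply (a b c y : List Bool) : cQ (boolPair (boolPair a (boolPair b c)) y) = c := by simp [cQ]

/-- `[0 < a]` (as `ltFn ⟨ε, ⌜a⌝⟩`). [folklore] -/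
def aPosQ : List Bool → List Bool := ltFn ∘ fanoutFn (fun _ => []) aQ

/-- `[0 < b]`. [folklore] -/
def bPosQ : List Bool → List Bool := ltFn ∘ fanoutFn (fun _ => []) bQ

/-- `[0 < ⟦y⟧]` (as `ltFn ⟨ε, y⟩`). [folklore] -/
def xPosQ : List Bool → List Bool := ltFn ∘ fanoutFn (fun _ => []) sndF

/-- `[⟦y⟧ < c]`. [folklore] -/
def xLtQ : List Bool → List Bool := ltFn ∘ fanoutFn sndF cQ

/-- `[⟦y⟧² mod b = a mod b]` (canonical numerals compared as strings). [cite: MandersAdleman1978, §2 (guess and check)] -/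
def congQ : List Bool → List Bool :=
  eqPairFn ∘ fanoutFn (remFn ∘ fanoutFn (prodFn ∘ fanoutFn sndF sndF) bQ) (remFn ∘ fanoutFn aQ bQ)

/-- `aPosQ ∈ FP`. [folklore] -/
theorem aPosQ_mem_FP : aPosQ ∈ FP := comp_mem_FP ltFn_mem_FP (fanoutFn_mem_FP (const_mem_FP _) aQ_mem_FP)

/-- `bPosQ ∈ FP`. [folklore] -/
theorem bPosQ_mem_FP : bPosQ ∈ FP := comp_mem_FP ltFn_mem_FP (fanoutFn_mem_FP (const_mem_FP _) bQ_mem_FP)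

/-- `xPosQ ∈ FP`. [folklore] -/
theorem xPosQ_mem_FP : xPosQ ∈ FP := comp_mem_FP ltFn_mem_FP (fanoutFn_mem_FP (const_mem_FP _) sndF_mem_FP)

/-- `xLtQ ∈ FP`. [folklore] -/
theorem xLtQ_mem_FP : xLtQ ∈ FP := comp_mem_FP ltFn_mem_FP (fanoutFn_mem_FP sndF_mem_FP cQ_mem_FP)

/-- `congQ ∈ FP`. [cite: AroraBarak2009, §1.3] -/
theorem congQ_mem_FP : congQ ∈ FP :=
  comp_mem_FP eqPairFn_mem_FP (fanoutFn_mem_FP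
    (comp_mem_FP remFn_mem_FP (fanoutFn_mem_FP (comp_mem_FP prodFn_mem_FP (fanoutFn_mem_FP sndF_mem_FP sndF_mem_FP))
      bQ_mem_FP))
    (comp_mem_FP remFn_mem_FP (fanoutFn_mem_FP aQ_mem_FP bQ_mem_FP)))

/-- `aPosQ` is one-bit. [folklore] -/
theorem oneBit_aPosQ : OneBit aPosQ := oneBit_ltFn.comp _

/-- `bPosQ` is one-bit. [folklore] -/
theorem oneBit_bPosQ : OneBit bPosQ := oneBit_ltFn.comp _

/-- `xPosQ` is one-bit. [folklore] -/
theorem oneBit_xPosQ : OneBit xPosQ := oneBit_ltFn.comp _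

/-- `xLtQ` is one-bit. [folklore] -/
theorem oneBit_xLtQ : OneBit xLtQ := oneBit_ltFn.comp _

/-- `congQ` is one-bit. [folklore] -/
theorem oneBit_congQ : OneBit congQ := oneBit_eqPairFn.comp _

/-- Value of `aPosQ` on a genuine argument. [folklore] -/
theorem aPosQ_apply (a b c : ℕ) (y : List Bool) :
    aPosQ (boolPair (boolPair (encodeNat a) (boolPair (encodeNat b) (encodeNat c))) y) = [decide (0 < a)] := by
  simp [aPosQ]

/-- Value of `bPosQ` on a genuine argument. [folklore] -/
theorem bPosQ_apply (a b c : ℕ) (y : List Bool) :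
    bPosQ (boolPair (boolPair (encodeNat a) (boolPair (encodeNat b) (encodeNat c))) y) = [decide (0 < b)] := by
  simp [bPosQ]

/-- Value of `xPosQ`. [folklore] -/
theorem xPosQ_apply (w y : List Bool) : xPosQ (boolPair w y) = [decide (0 < bitsToNat y)] := by
  simp [xPosQ]

/-- Value of `xLtQ` on a genuine argument. [folklore] -/
theorem xLtQ_apply (a b c : ℕ) (y : List Bool) :
    xLtQ (boolPair (boolPair (encodeNat a) (boolPair (encodeNat b) (encodeNat c))) y) = [decide (bitsToNat y < c)] := by
  simp [xLtQ]

/-- Value of `congQ` on a genuine argument. [folklore] -/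
theorem congQ_apply (a b c : ℕ) (y : List Bool) :
    congQ (boolPair (boolPair (encodeNat a) (boolPair (encodeNat b) (encodeNat c))) y) =
      [decide (bitsToNat y * bitsToNat y % b = a % b)] := by
  rw [congQ, Function.comp_apply, fanoutFn_apply, eqPairFn_boolPair]
  simp only [Function.comp_apply, fanoutFn_apply, aQ_apply, bQ_apply, sndF_boolPair, remFn_boolPair,
    prodFn_boolPair, bitsToNat_encodeNat]
  rw [Bool.decide_congr encodeNat_inj]

/-! ### The verifier and `QUADCONG ∈ NP` -/

/-- **The QUADRATIC CONGRUENCES verifier** ("guess a solution and check whether it is correct"): on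
`⟨w, y⟩`, the bit "`w` is the canonical code of some `(a, b, c)` with `a, b > 0`, and `x = ⟦y⟧` has
`0 < x < c` and `x² ≡ a (mod b)`". [cite: MandersAdleman1978, §2 (proof of Thms. 1–2)] -/
def verQ : List Bool → List Bool :=
  andFn (isCanonQFn ∘ fstF) (andFn aPosQ (andFn bPosQ (andFn xPosQ (andFn xLtQ congQ))))

/-- **The verifier is polynomial time.** [cite: MandersAdleman1978, §2] [cite: AroraBarak2009, §1.3] -/
theorem verQ_mem_FP : verQ ∈ FP :=
  andFn_mem_FP (comp_mem_FP isCanonQFn_mem_FP fstF_mem_FP) (andFn_mem_FP aPosQ_mem_FP (andFn_mem_FP bPosQ_mem_FP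
    (andFn_mem_FP xPosQ_mem_FP (andFn_mem_FP xLtQ_mem_FP congQ_mem_FP))))

/-- The verifier is one-bit. [folklore] -/
theorem oneBit_verQ : OneBit verQ :=
  oneBit_andFn (oneBit_isCanonQFn.comp _) (oneBit_andFn oneBit_aPosQ (oneBit_andFn oneBit_bPosQ
    (oneBit_andFn oneBit_xPosQ (oneBit_andFn oneBit_xLtQ oneBit_congQ))))

/-- **Value of the verifier on a genuine instance code.** [cite: MandersAdleman1978, §2] -/
theorem verQ_encode (a b c : ℕ) (y : List Bool) :
    verQ (boolPair (encodingQuadCong.encode (a, b, c)) y) =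
      [decide (0 < a) && (decide (0 < b) && (decide (0 < bitsToNat y) && (decide (bitsToNat y < c) &&
        decide (bitsToNat y * bitsToNat y % b = a % b))))] := by
  rw [encodingQuadCong_encode]
  have hc : (isCanonQFn ∘ fstF) (boolPair (boolPair (encodeNat a) (boolPair (encodeNat b) (encodeNat c))) y) = [true] := by
    rw [Function.comp_apply, fstF_boolPair, isCanonQFn_apply, ← encodingQuadCong_encode, decQ_encode]; simp
  rw [verQ, andFn_apply hc (andFn_apply (aPosQ_apply a b c y) (andFn_apply (bPosQ_apply a b c y)
    (andFn_apply (xPosQ_apply _ y) (andFn_apply (xLtQ_apply a b c y) (congQ_apply a b c y))))), Bool.true_and]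

/-- Value of the verifier on a non-code. [folklore] -/
theorem verQ_of_not_canon {x : List Bool} (hx : encodingQuadCong.encode (decQ x) ≠ x) (y : List Bool) :
    verQ (boolPair x y) = [false] := by
  have hc : (isCanonQFn ∘ fstF) (boolPair x y) = [false] := by
    rw [Function.comp_apply, fstF_boolPair, isCanonQFn_apply]; simp [hx]
  obtain ⟨b, hb⟩ := (oneBit_andFn oneBit_aPosQ (oneBit_andFn oneBit_bPosQ
    (oneBit_andFn oneBit_xPosQ (oneBit_andFn oneBit_xLtQ oneBit_congQ)))) (boolPair x y)
  rw [verQ, andFn_apply hc hb, Bool.false_and]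

/-- The verifier's language `{z | verQ z = [1]}`. [cite: MandersAdleman1978, §2] -/
def verLangQ : Language Bool := {z | verQ z = [true]}

/-- **The verifier's language is in `P`.** [cite: MandersAdleman1978, §2] -/
theorem verLangQ_mem_P : verLangQ ∈ Classes.P :=
  mem_P_of_mem_FP verQ_mem_FP _ fun w => ⟨id, fun hw => by
    obtain ⟨b, hb⟩ := oneBit_verQ w
    cases b
    · exact hb
    · exact absurd hb hw⟩

end QuadCong

open QuadCong Polynomial _root_.Computability in
/-- **QUADRATIC CONGRUENCES is in `NP`** (Manders–Adleman 1978, §2: "solvable by a nondeterministic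
'guess a solution and check whether it is correct' algorithm in polynomial time … there is a bound
on the size of possible solutions"): the certificate of the code of `(a, b, c)` is the numeral of a
solution `x`, `0 < x < c`, of length `≤ |⌜c⌝| ≤ |code|`; the verifier is `QuadCong.verQ`.
[cite: MandersAdleman1978, §2 (Thm. 2, membership)] [cite: GareyJohnson1979, §A7.1 problem AN1] -/
theorem QUADCONG_mem_NP : QUADCONG ∈ Nondeterministic.NP := by
  refine ⟨verLangQ, verLangQ_mem_P, X, fun w => ?_⟩
  show w ∈ QUADCONG ↔ ∃ y, y.length ≤ X.eval w.length ∧ verQ (boolPair w y) = [true]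
  constructor
  · intro hw
    obtain ⟨a, b, c, rfl, ha, hb, x, hx0, hxc, hx⟩ := (mem_QUADCONG_iff w).1 hw
    refine ⟨encodeNat x, ?_, ?_⟩
    · rw [eval_X, length_boolPair, length_boolPair]
      have := Brick.length_encodeNat_mono hxc.le
      omega
    · rw [← encodingQuadCong_encode, verQ_encode]
      have hx' : x * x % b = a % b := by rw [← pow_two]; exact hx
      simp [ha, hb, bitsToNat_encodeNat, hx0, hxc, hx']
  · rintro ⟨y, -, hy⟩
    by_cases hc : encodingQuadCong.encode (decQ w) = w
    · rw [← hc] at hy ⊢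
      rw [show decQ w = ((decQ w).1, (decQ w).2.1, (decQ w).2.2) from rfl] at hy ⊢
      rw [verQ_encode] at hy
      simp only [List.cons.injEq, and_true, Bool.and_eq_true, decide_eq_true_eq] at hy
      obtain ⟨ha, hb, hx0, hxc, hx⟩ := hy
      rw [encodingQuadCong_encode, boolPair_mem_QUADCONG_iff, mem_quadCongSet_iff]
      exact ⟨ha, hb, bitsToNat y, hx0, hxc, by rw [Nat.ModEq, pow_two]; exact hx⟩
    · rw [verQ_of_not_canon hc] at hy
      exact absurd hy (by simp)

end Literature.Computability.Complexity

end
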